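import Summits.QuantumFields.YangMills.Theorems.LuscherReductionRunningReductionAxialGaugeInner
import HarnessLib

/-!
# Weighted Schur test in axial gauge: a ROW super-solution bound for the axial kernel on an `Ad`-invariant region bounds the transfer form
# (door for VALLEY GAIN `V(L)` — fixed-lattice programme COARSE(L₀); route `LuscherReduction`, crux RED stmt-QuantumFields-19978 KT-door 3b′ /
# crux `TwistedTraceScaling` stmt-QuantumFields-20203 S-BASE; design note `pub/ym-fleet/ym-luscher-20007-p1/COARSE-DESIGN.md` §7 (C3), §10)

Companion of `…AxialGauge` (`qform_eq_axial`, `l2_eq_axial`).  The axial kernel `A_β = axialKernel β` is not manifestly symmetric pointwise, but it is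
symmetric as a BILINEAR FORM on `Ad`-invariant functions of the non-tree links (those are exactly the comb-gauge readings `pullComb f` of gauge-invariant
functions, and `K_β` is symmetric).  Hence the weighted Schur test needs only the ROW bound:
* §1 `pullComb f U = f (treeFix U |off)`: gauge invariant for `Ad`-invariant `f`, `pullComb f ∘ glue = f`;
* §2 `biform_eq_axial` (two-function version of `qform_eq_axial`), `biform_comm` (symmetry of `∫ G₁ K G₂` for bounded measurable `G₁, G₂`),
  ★ `axialBiform_comm`: `∫ f₁(w) ∫ A(w,w') f₂(w') = ∫ f₂(w) ∫ A(w,w') f₁(w')` for bounded measurable `Ad`-invariant `f₁, f₂`;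
* §3 ★★ `qform_le_of_axialRow`: `G` gauge invariant, bounded, measurable, with `G ∘ glue` supported in an `Ad`-invariant measurable region `R`;
  `h` measurable, `Ad`-invariant, `0 < c ≤ h ≤ C`; if `∫_R A_β(w,w') h(w') dw' ≤ Λ h(w)` for every `w ∈ R` then `⟨G, K_β G⟩ ≤ Λ ‖G‖²`
  (AM–GM with the weight `h(w')/h(w)`, the second half by the bilinear symmetry).
So VALLEY GAIN `V(L)` ⇐ an `Ad`-invariant positive weight on `SU(2)^{off}` with row bound `e^{−Aλ_b} λ₀` on the glue-preimage of the valley region.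
HONEST FRAMING: an abstract door; no weight is constructed here; femto rung R2b1; not infinite volume, not a gap, not Clay.
-/

set_option autoImplicit false

noncomputable section

open MeasureTheory Filter Topology Real
open scoped Matrix ComplexConjugate BigOperators
open Literature.MathematicalPhysics.QuantumFieldTheory
open Literature.MathematicalPhysics.QuantumLattice

namespace Summit.QuantumFields.YangMills.Theorems.FemtoTransferGap

variable {L : ℕ} [NeZero L]

/-! ## §1 Comb-gauge readings of gauge-invariant functions -/

/-- **Comb-gauge reading**: `pullComb f U = f (non-tree links of treeFix U)`. [folklore] -/
def pullComb (f : (OffIdx L → SU2) → ℝ) (U : GaugeConfig 3 L SU2) : ℝ := f fun i : OffIdx L => treeFix U i.1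

/-- `pullComb f (glue w) = f w`. [folklore] -/
theorem pullComb_glue (f : (OffIdx L → SU2) → ℝ) (w : OffIdx L → SU2) : pullComb f (glue w) = f w := by
  unfold pullComb
  rw [treeFix_glue]
  congr 1
  funext i
  exact glue_apply_of_not_tree w i.2

/-- `pullComb f` is measurable for measurable `f`. [folklore] -/
theorem measurable_pullComb {f : (OffIdx L → SU2) → ℝ} (hf : Measurable f) : Measurable (pullComb (L := L) f) :=
  hf.comp (measurable_pi_lambda _ fun i => (measurable_pi_apply i.1).comp measurable_treeFix)

/-- `pullComb f` is gauge invariant when `f` is invariant under global conjugation. [folklore] -/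
theorem pullComb_gaugeTransform {f : (OffIdx L → SU2) → ℝ} (hAd : ∀ (k : SU2) (w : OffIdx L → SU2), f (fun i => k * w i * k⁻¹) = f w)
    (g : Site 3 L → SU2) (U : GaugeConfig 3 L SU2) : pullComb f (gaugeTransform g U) = pullComb f U := by
  unfold pullComb
  rw [treeFix_gaugeTransform]
  exact hAd (g 0) fun i : OffIdx L => treeFix U i.1

omit [NeZero L] in
/-- `|pullComb f| ≤ C` if `|f| ≤ C`. [folklore] -/
theorem abs_pullComb_le {f : (OffIdx L → SU2) → ℝ} {C : ℝ} (hC : ∀ w, |f w| ≤ C) (U : GaugeConfig 3 L SU2) : |pullComb f U| ≤ C := hC _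

/-! ## §2 The bilinear form in axial gauge and its symmetry -/

/-- **Two-function axial identity**: for gauge-invariant bounded measurable `G₁, G₂` and `β ≥ 0`,
`∫ G₁(U) (∫ K_β(U,V) G₂(V) dV) dU = ∫ G₁(glue w) (∫ A_β(w,w') G₂(glue w') dw') dw`. [cite: SeilerLNP1982, §3] -/
theorem biform_eq_axial {β : ℝ} (hβ : 0 ≤ β) {G₁ G₂ : GaugeConfig 3 L SU2 → ℝ} (h1m : Measurable G₁) (h2m : Measurable G₂) {C₂ : ℝ}
    (h2b : ∀ U, |G₂ U| ≤ C₂) (h1g : ∀ (g : Site 3 L → SU2) (U : GaugeConfig 3 L SU2), G₁ (gaugeTransform g U) = G₁ U)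
    (h2g : ∀ (g : Site 3 L → SU2) (U : GaugeConfig 3 L SU2), G₂ (gaugeTransform g U) = G₂ U) :
    ∫ U, G₁ U * ∫ V, transferKernel su2Rep β U V * G₂ V ∂configMeasure SU2 L ∂configMeasure SU2 L =
      ∫ w, G₁ (glue w) * ∫ w', axialKernel β w w' * G₂ (glue w') ∂(Measure.pi fun _ : OffIdx L => haarProbability SU2)
        ∂(Measure.pi fun _ : OffIdx L => haarProbability SU2) := by
  have hm : Measurable (fun U : GaugeConfig 3 L SU2 => G₁ U * ∫ V, transferKernel su2Rep β U V * G₂ V ∂configMeasure SU2 L) :=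
    h1m.mul (measurable_transferPotential β h2m)
  rw [integral_eq_integral_killTree_of_gaugeInvariant hm (fun g U => by rw [h1g, transferPotential_gaugeTransform β h2m h2g])]
  simp_rw [killTree_eq_glue]
  have hm2 : Measurable (fun w : OffIdx L → SU2 => G₁ (glue w) * ∫ V, transferKernel su2Rep β (glue w) V * G₂ V ∂configMeasure SU2 L) :=
    (h1m.comp measurable_glue).mul ((measurable_transferPotential β h2m).comp measurable_glue)
  rw [integral_off_marginal hm2]
  refine integral_congr_ae (ae_of_all _ fun w => ?_)
  simp only
  rw [transferPotential_glue_eq_axial hβ h2m h2b h2g w]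

/-- **Symmetry of the transfer bilinear form** for bounded measurable functions: `∫ G₁ (K_β G₂) = ∫ G₂ (K_β G₁)` (`β ≥ 0`). [folklore] -/
theorem biform_comm {β : ℝ} (hβ : 0 ≤ β) {G₁ G₂ : GaugeConfig 3 L SU2 → ℝ} (h1m : Measurable G₁) (h2m : Measurable G₂) {C₁ C₂ : ℝ}
    (h1b : ∀ U, |G₁ U| ≤ C₁) (h2b : ∀ U, |G₂ U| ≤ C₂) :
    ∫ U, G₁ U * ∫ V, transferKernel su2Rep β U V * G₂ V ∂configMeasure SU2 L ∂configMeasure SU2 L =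
      ∫ U, G₂ U * ∫ V, transferKernel su2Rep β U V * G₁ V ∂configMeasure SU2 L ∂configMeasure SU2 L := by
  have hint := integrable_latSandwich (measurable_transferKernel_lat β) (abs_transferKernel_le_lat hβ) h1m h2m h1b h2b
  have hint' := integrable_latSandwich (measurable_transferKernel_lat β) (abs_transferKernel_le_lat hβ) h2m h1m h2b h1b
  have e1 : ∫ U, G₁ U * ∫ V, transferKernel su2Rep β U V * G₂ V ∂configMeasure SU2 L ∂configMeasure SU2 L =
      ∫ p, G₁ p.1 * transferKernel su2Rep β p.1 p.2 * G₂ p.2 ∂(configMeasure SU2 L).prod (configMeasure SU2 L) := by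
    rw [integral_prod _ hint]
    refine integral_congr_ae (ae_of_all _ fun U => ?_)
    simp only
    rw [← integral_const_mul]
    refine integral_congr_ae (ae_of_all _ fun V => ?_)
    simp only; ring
  have e2 : ∫ U, G₂ U * ∫ V, transferKernel su2Rep β U V * G₁ V ∂configMeasure SU2 L ∂configMeasure SU2 L =
      ∫ p, G₂ p.1 * transferKernel su2Rep β p.1 p.2 * G₁ p.2 ∂(configMeasure SU2 L).prod (configMeasure SU2 L) := by
    rw [integral_prod _ hint']
    refine integral_congr_ae (ae_of_all _ fun U => ?_)
    simp only
    rw [← integral_const_mul]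
    refine integral_congr_ae (ae_of_all _ fun V => ?_)
    simp only; ring
  rw [e1, e2, ← integral_prod_swap]
  refine integral_congr_ae (ae_of_all _ fun p => ?_)
  simp only [Prod.fst_swap, Prod.snd_swap, transferKernel_su2Rep_symm β p.2 p.1]
  ring

/-- ★ **The axial kernel is symmetric as a bilinear form on `Ad`-invariant functions**: for bounded measurable `f₁, f₂` on the non-tree links,
invariant under global conjugation, `∫ f₁(w) ∫ A_β(w,w') f₂(w') = ∫ f₂(w) ∫ A_β(w,w') f₁(w')` (`β ≥ 0`). [folklore] -/
theorem axialBiform_comm {β : ℝ} (hβ : 0 ≤ β) {f₁ f₂ : (OffIdx L → SU2) → ℝ} (h1m : Measurable f₁) (h2m : Measurable f₂) {C₁ C₂ : ℝ}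
    (h1b : ∀ w, |f₁ w| ≤ C₁) (h2b : ∀ w, |f₂ w| ≤ C₂)
    (h1A : ∀ (k : SU2) (w : OffIdx L → SU2), f₁ (fun i => k * w i * k⁻¹) = f₁ w)
    (h2A : ∀ (k : SU2) (w : OffIdx L → SU2), f₂ (fun i => k * w i * k⁻¹) = f₂ w) :
    ∫ w, f₁ w * ∫ w', axialKernel β w w' * f₂ w' ∂(Measure.pi fun _ : OffIdx L => haarProbability SU2)
        ∂(Measure.pi fun _ : OffIdx L => haarProbability SU2) =
      ∫ w, f₂ w * ∫ w', axialKernel β w w' * f₁ w' ∂(Measure.pi fun _ : OffIdx L => haarProbability SU2)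
        ∂(Measure.pi fun _ : OffIdx L => haarProbability SU2) := by
  have h1 := biform_eq_axial hβ (measurable_pullComb h1m) (measurable_pullComb h2m) (abs_pullComb_le h2b)
    (pullComb_gaugeTransform h1A) (pullComb_gaugeTransform h2A)
  have h2 := biform_eq_axial hβ (measurable_pullComb h2m) (measurable_pullComb h1m) (abs_pullComb_le h1b)
    (pullComb_gaugeTransform h2A) (pullComb_gaugeTransform h1A)
  simp only [pullComb_glue] at h1 h2
  rw [← h1, ← h2]
  exact biform_comm hβ (measurable_pullComb h1m) (measurable_pullComb h2m) (abs_pullComb_le h1b) (abs_pullComb_le h2b)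

/-! ## §3 The weighted Schur test from a row bound -/

/-- The axial kernel is jointly measurable. [folklore] -/
theorem measurable_axialKernel_uncurry (β : ℝ) :
    Measurable fun p : (OffIdx L → SU2) × (OffIdx L → SU2) => axialKernel β p.1 p.2 := by
  -- the integrand in UNCURRIED form (a direct `Measurable.comp` with the binary kernel times out at `whnf`)
  have hφ : Measurable (fun q : ((OffIdx L → SU2) × (OffIdx L → SU2)) × (TreeIdx L → SU2) =>
      ((glue q.1.1, recon (q.2, q.1.2)) : GaugeConfig 3 L SU2 × GaugeConfig 3 L SU2)) :=
    (measurable_glue.comp (measurable_fst.comp measurable_fst)).prodMk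
      (measurable_recon.comp (measurable_snd.prodMk (measurable_snd.comp measurable_fst)))
  have hK : Measurable (Function.uncurry (transferKernel (L := L) su2Rep β)) := measurable_transferKernel_lat β
  have h3 : Measurable fun q : ((OffIdx L → SU2) × (OffIdx L → SU2)) × (TreeIdx L → SU2) =>
      Function.uncurry (transferKernel (L := L) su2Rep β) (glue q.1.1, recon (q.2, q.1.2)) := hK.comp hφ
  exact (h3.stronglyMeasurable.integral_prod_right' (ν := Measure.pi fun _ : TreeIdx L => haarProbability SU2)).measurable

/-- Sandwich integrability on the product of the non-tree Haar measures: `a(w) A_β(w,w') b(w')` for bounded measurable `a, b` (`β ≥ 0`). [folklore] -/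
theorem integrable_axialSandwich {β : ℝ} (hβ : 0 ≤ β) {a b : (OffIdx L → SU2) → ℝ} (ham : Measurable a) (hbm : Measurable b) {Ca Cb : ℝ}
    (hab : ∀ w, |a w| ≤ Ca) (hbb : ∀ w, |b w| ≤ Cb) :
    Integrable (fun p : (OffIdx L → SU2) × (OffIdx L → SU2) => a p.1 * axialKernel β p.1 p.2 * b p.2)
      ((Measure.pi fun _ : OffIdx L => haarProbability SU2).prod (Measure.pi fun _ : OffIdx L => haarProbability SU2)) := by
  have hCa : 0 ≤ Ca := (abs_nonneg _).trans (hab 1)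
  refine Integrable.of_bound ((((ham.comp measurable_fst).mul (measurable_axialKernel_uncurry β)).mul (hbm.comp measurable_snd)).aestronglyMeasurable)
    (Ca * Real.exp (2 * β) ^ Fintype.card (Edge 3 L) * Cb) (ae_of_all _ fun p => ?_)
  rw [Real.norm_eq_abs, abs_mul, abs_mul, abs_of_nonneg (axialKernel_nonneg β p.1 p.2)]
  exact mul_le_mul (mul_le_mul (hab _) (axialKernel_le hβ _ _) (axialKernel_nonneg β _ _) hCa) (hbb _) (abs_nonneg _) (by positivity)

/-- Iterated = product form for the axial sandwich. [folklore] -/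
theorem integral_axialSandwich_eq {β : ℝ} (hβ : 0 ≤ β) {a b : (OffIdx L → SU2) → ℝ} (ham : Measurable a) (hbm : Measurable b) {Ca Cb : ℝ}
    (hab : ∀ w, |a w| ≤ Ca) (hbb : ∀ w, |b w| ≤ Cb) :
    ∫ w, a w * ∫ w', axialKernel β w w' * b w' ∂(Measure.pi fun _ : OffIdx L => haarProbability SU2) ∂(Measure.pi fun _ : OffIdx L => haarProbability SU2) =
      ∫ p, a p.1 * axialKernel β p.1 p.2 * b p.2
        ∂(Measure.pi fun _ : OffIdx L => haarProbability SU2).prod (Measure.pi fun _ : OffIdx L => haarProbability SU2) := by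
  rw [integral_prod _ (integrable_axialSandwich hβ ham hbm hab hbb)]
  refine integral_congr_ae (ae_of_all _ fun w => ?_)
  simp only
  rw [← integral_const_mul]
  refine integral_congr_ae (ae_of_all _ fun w' => ?_)
  simp only; ring

/-- ★★ **Weighted Schur test in axial gauge from a ROW bound.**  Let `G` be gauge invariant, bounded and measurable with `G ∘ glue` supported in a
measurable region `R ⊆ SU(2)^{off}` invariant under global conjugation; let `h` be a measurable `Ad`-invariant weight with `0 < c ≤ h ≤ C`; and suppose
the row bound `∫_R A_β(w,w') h(w') dw' ≤ Λ h(w)` for every `w ∈ R`.  Then `⟨G, K_β G⟩ ≤ Λ ‖G‖²` (`β ≥ 0`).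
[cite: Grafakos2009, App. A.2, Lemma ((iii) ⇒ (i), p = 2)] -/
theorem qform_le_of_axialRow {β : ℝ} (hβ : 0 ≤ β) {G : GaugeConfig 3 L SU2 → ℝ} (hGm : Measurable G) {CG : ℝ} (hGb : ∀ U, |G U| ≤ CG)
    (hGg : ∀ (g : Site 3 L → SU2) (U : GaugeConfig 3 L SU2), G (gaugeTransform g U) = G U)
    {R : Set (OffIdx L → SU2)} (hR : MeasurableSet R) (hRA : ∀ (k : SU2) (w : OffIdx L → SU2), (fun i => k * w i * k⁻¹) ∈ R ↔ w ∈ R)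
    (hsupp : ∀ w, G (glue w) ≠ 0 → w ∈ R)
    {h : (OffIdx L → SU2) → ℝ} (hhm : Measurable h) {c C : ℝ} (hc : 0 < c) (hch : ∀ w, c ≤ h w) (hhC : ∀ w, h w ≤ C)
    (hhA : ∀ (k : SU2) (w : OffIdx L → SU2), h (fun i => k * w i * k⁻¹) = h w)
    {Λ : ℝ} (hrow : ∀ w ∈ R, ∫ w', R.indicator (fun w' => axialKernel β w w' * h w') w' ∂(Measure.pi fun _ : OffIdx L => haarProbability SU2) ≤ Λ * h w) :
    qform su2Rep β G G ≤ Λ * l2 G G := by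
  set ν : Measure (OffIdx L → SU2) := Measure.pi fun _ : OffIdx L => haarProbability SU2 with hν
  set g : (OffIdx L → SU2) → ℝ := fun w => G (glue w) with hg
  have hgm : Measurable g := hGm.comp measurable_glue
  have hgb : ∀ w, |g w| ≤ CG := fun w => hGb _
  have hCG : 0 ≤ CG := (abs_nonneg _).trans (hGb 1)
  have hhpos : ∀ w, 0 < h w := fun w => lt_of_lt_of_le hc (hch w)
  have hC0 : 0 < C := lt_of_lt_of_le (hhpos 1) (hhC 1)
  have hg0 : ∀ w, w ∉ R → g w = 0 := fun w hw => by by_contra hne; exact hw (hsupp w hne)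
  -- the two auxiliary Ad-invariant functions
  set f₁ : (OffIdx L → SU2) → ℝ := fun w => R.indicator h w with hf₁
  set f₂ : (OffIdx L → SU2) → ℝ := fun w => R.indicator (fun w => g w ^ 2 / h w) w with hf₂
  have hf₁m : Measurable f₁ := hhm.indicator hR
  have hf₂m : Measurable f₂ := ((hgm.pow_const 2).div hhm).indicator hR
  have hf₁b : ∀ w, |f₁ w| ≤ C := fun w => by
    rw [hf₁]; dsimp only
    by_cases hw : w ∈ R
    · rw [Set.indicator_of_mem hw, abs_of_pos (hhpos w)]; exact hhC w
    · rw [Set.indicator_of_notMem hw, abs_zero]; exact hC0.le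
  have hf₂b : ∀ w, |f₂ w| ≤ CG ^ 2 / c := fun w => by
    rw [hf₂]; dsimp only
    by_cases hw : w ∈ R
    · rw [Set.indicator_of_mem hw, abs_div, abs_of_pos (hhpos w), abs_pow]
      exact div_le_div₀ (by positivity) (pow_le_pow_left₀ (abs_nonneg _) (hgb w) 2) hc (hch w)
    · rw [Set.indicator_of_notMem hw, abs_zero]; positivity
  have hAdR : ∀ (k : SU2) (w : OffIdx L → SU2) (φ : (OffIdx L → SU2) → ℝ), (∀ w, φ (fun i => k * w i * k⁻¹) = φ w) →
      R.indicator φ (fun i => k * w i * k⁻¹) = R.indicator φ w := fun k w φ hφ => by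
    by_cases hw : w ∈ R
    · rw [Set.indicator_of_mem hw, Set.indicator_of_mem ((hRA k w).mpr hw), hφ]
    · rw [Set.indicator_of_notMem hw, Set.indicator_of_notMem (fun h' => hw ((hRA k w).mp h'))]
  have hgA : ∀ (k : SU2) (w : OffIdx L → SU2), g (fun i => k * w i * k⁻¹) = g w := fun k w => by
    rw [hg]; dsimp only
    have e : glue (fun i : OffIdx L => k * w i * k⁻¹) = gaugeTransform (fun _ : Site 3 L => k) (glue w) := by
      funext e
      rw [gaugeTransform_const_apply]
      by_cases he : treeEdge e = true
      · rw [glue_apply_of_tree _ he, glue_apply_of_tree _ he, mul_one, mul_inv_cancel]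
      · rw [glue_apply_of_not_tree _ he, glue_apply_of_not_tree _ he]
    rw [e, hGg]
  have hf₁A : ∀ (k : SU2) (w : OffIdx L → SU2), f₁ (fun i => k * w i * k⁻¹) = f₁ w := fun k w => hAdR k w h (hhA k)
  have hf₂A : ∀ (k : SU2) (w : OffIdx L → SU2), f₂ (fun i => k * w i * k⁻¹) = f₂ w := fun k w =>
    hAdR k w (fun w => g w ^ 2 / h w) fun w => by simp only [hgA, hhA]
  -- pointwise AM–GM: `g(w) A g(w') ≤ ½ (f₂(w)·A·f₁(w') + f₁(w)·A·f₂(w'))`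
  have hptw : ∀ p : (OffIdx L → SU2) × (OffIdx L → SU2), g p.1 * axialKernel β p.1 p.2 * g p.2 ≤
      (1 / 2) * (f₂ p.1 * axialKernel β p.1 p.2 * f₁ p.2) + (1 / 2) * (f₁ p.1 * axialKernel β p.1 p.2 * f₂ p.2) := by
    rintro ⟨w, w'⟩
    dsimp only
    by_cases hw : w ∈ R
    · by_cases hw' : w' ∈ R
      · rw [hf₁, hf₂]; dsimp only
        rw [Set.indicator_of_mem hw, Set.indicator_of_mem hw', Set.indicator_of_mem hw, Set.indicator_of_mem hw']
        have hA := axialKernel_nonneg β w w'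
        have h1 := hhpos w
        have h2 := hhpos w'
        have key : 2 * (g w * g w') ≤ g w ^ 2 / h w * h w' + h w * (g w' ^ 2 / h w') := by
          have e : g w ^ 2 / h w * h w' + h w * (g w' ^ 2 / h w') - 2 * (g w * g w') = (g w * h w' - g w' * h w) ^ 2 / (h w * h w') := by
            field_simp
            ring
          have : 0 ≤ (g w * h w' - g w' * h w) ^ 2 / (h w * h w') := by positivity
          linarith
        nlinarith
      · rw [hg0 w' hw', mul_zero, hf₁, hf₂]; dsimp only
        rw [Set.indicator_of_notMem hw', Set.indicator_of_notMem hw']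
        simp
    · rw [hg0 w hw, zero_mul, zero_mul, hf₁, hf₂]; dsimp only
      rw [Set.indicator_of_notMem hw, Set.indicator_of_notMem hw]
      simp
  -- product-measure forms
  have hI0 := integrable_axialSandwich hβ hgm hgm hgb hgb
  have hI1 := integrable_axialSandwich hβ hf₂m hf₁m hf₂b hf₁b
  have hI2 := integrable_axialSandwich hβ hf₁m hf₂m hf₁b hf₂b
  have hP0 : qform su2Rep β G G = ∫ p, g p.1 * axialKernel β p.1 p.2 * g p.2 ∂ν.prod ν := by
    rw [qform_eq_axial hβ hGm hGb hGg, ← integral_axialSandwich_eq hβ hgm hgm hgb hgb]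
    refine integral_congr_ae (ae_of_all _ fun w => ?_)
    simp only
    rw [← integral_const_mul]
    refine integral_congr_ae (ae_of_all _ fun w' => ?_)
    simp only [hg]; ring
  have hsymm : ∫ p, f₁ p.1 * axialKernel β p.1 p.2 * f₂ p.2 ∂ν.prod ν = ∫ p, f₂ p.1 * axialKernel β p.1 p.2 * f₁ p.2 ∂ν.prod ν := by
    rw [← integral_axialSandwich_eq hβ hf₁m hf₂m hf₁b hf₂b, ← integral_axialSandwich_eq hβ hf₂m hf₁m hf₂b hf₁b]
    exact axialBiform_comm hβ hf₁m hf₂m hf₁b hf₂b hf₁A hf₂A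
  -- the row bound, integrated
  have hP1 : ∫ p, f₂ p.1 * axialKernel β p.1 p.2 * f₁ p.2 ∂ν.prod ν ≤ Λ * ∫ w, g w * g w ∂ν := by
    rw [← integral_axialSandwich_eq hβ hf₂m hf₁m hf₂b hf₁b, ← integral_const_mul]
    have hL : Integrable (fun w => f₂ w * ∫ w', axialKernel β w w' * f₁ w' ∂ν) ν := by
      have h := hI1.integral_prod_left
      refine h.congr (ae_of_all _ fun w => ?_)
      simp only
      rw [← integral_const_mul]
      refine integral_congr_ae (ae_of_all _ fun w' => ?_)
      simp only; ring
    have hggm : Measurable (fun w : OffIdx L → SU2 => g w * g w) := hgm.mul hgm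
    have hgg : Integrable (fun w : OffIdx L → SU2 => g w * g w) ν :=
      Integrable.of_bound hggm.aestronglyMeasurable (CG * CG) (ae_of_all _ fun w => by
        rw [Real.norm_eq_abs, abs_mul]; exact mul_le_mul (hgb w) (hgb w) (abs_nonneg _) hCG)
    have hRt : Integrable (fun w => Λ * (g w * g w)) ν := hgg.const_mul Λ
    refine integral_mono hL hRt fun w => ?_
    simp only
    by_cases hw : w ∈ R
    · have hinner : ∫ w', axialKernel β w w' * f₁ w' ∂ν = ∫ w', R.indicator (fun w' => axialKernel β w w' * h w') w' ∂ν := by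
        refine integral_congr_ae (ae_of_all _ fun w' => ?_)
        rw [hf₁]; dsimp only
        by_cases hw' : w' ∈ R
        · rw [Set.indicator_of_mem hw', Set.indicator_of_mem hw']
        · rw [Set.indicator_of_notMem hw', Set.indicator_of_notMem hw', mul_zero]
      rw [hinner, hf₂]; dsimp only
      rw [Set.indicator_of_mem hw]
      have hq : 0 ≤ g w ^ 2 / h w := div_nonneg (sq_nonneg _) (hhpos w).le
      have hne : h w ≠ 0 := (hhpos w).ne'
      calc g w ^ 2 / h w * ∫ w', R.indicator (fun w' => axialKernel β w w' * h w') w' ∂ν ≤ g w ^ 2 / h w * (Λ * h w) :=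
            mul_le_mul_of_nonneg_left (hrow w hw) hq
        _ = Λ * (g w * g w) := by field_simp
    · rw [hf₂]; dsimp only
      rw [Set.indicator_of_notMem hw, zero_mul, hg0 w hw, mul_zero, mul_zero]
  -- assemble
  rw [hP0, l2_eq_axial hGm hGg]
  calc ∫ p, g p.1 * axialKernel β p.1 p.2 * g p.2 ∂ν.prod ν
      ≤ ∫ p, ((1 / 2) * (f₂ p.1 * axialKernel β p.1 p.2 * f₁ p.2) + (1 / 2) * (f₁ p.1 * axialKernel β p.1 p.2 * f₂ p.2)) ∂ν.prod ν :=
        integral_mono hI0 ((hI1.const_mul _).add (hI2.const_mul _)) hptw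
    _ = (1 / 2) * ∫ p, f₂ p.1 * axialKernel β p.1 p.2 * f₁ p.2 ∂ν.prod ν + (1 / 2) * ∫ p, f₁ p.1 * axialKernel β p.1 p.2 * f₂ p.2 ∂ν.prod ν := by
        rw [integral_add (hI1.const_mul _) (hI2.const_mul _), integral_const_mul, integral_const_mul]
    _ = ∫ p, f₂ p.1 * axialKernel β p.1 p.2 * f₁ p.2 ∂ν.prod ν := by rw [hsymm]; ring
    _ ≤ Λ * ∫ w, g w * g w ∂ν := hP1

end Summit.QuantumFields.YangMills.Theorems.FemtoTransferGap

end
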